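import Summits.HodgeConjecture.HodgeConjecture.Theorems.F0P3cStCharTSEllInnerGRegroup   -- ★ (E0) p852642 (this seat): §1–§3 (pointwise density, `integrable_ncard_mul`, the heads with the total Haar instance); brings ★ (E0a), ★ (E0-count), ★ (P3), ★ (Θ)
import HarnessLib

/-!
# F0 · P3c · line LH6 «StCharTS» — road «ELL-INNER», brick (E0)′ «G-REGROUP, PER-MEMBER HAAR LETTER»: the two heads of ★ (E0) `F0P3cStCharTSEllInnerGRegroup` re-lettered with
# `htHh : ∀ T ∈ SH, (tH T).IsHaarMeasure` + `htHp : ∀ T ∈ SH, IsProbabilityMeasure (tH T)` (★ R8's `hHaarHO`∕`hprobHO` verbatim) in place of the total instance + `htH` (Rogawski 1990 §12.5 pp. 182–184)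

Cell `pub/hodgecm-mathlib`, crux H413 = `stmt-HodgeConjecture-24833` (lane `--supports … --as helper`, count-neutral); seat LH6-p03 (g7), «ELL-INNER» map owner.  THEOREMS ONLY; ★-only imports;
axioms TRIO.  WHY: at the rider the `H`-side measures are ★ R8's `μTHf`, Haar ONLY ON THE MEMBERS (`hHaarHO : ∀ T′ ∈ SH, (μTHf T′).IsHaarMeasure`); no total family on
all subgroups of `H_v` can be Haar (non-closed subgroups), so F (`prop1252_concrete`, F0P3a-p06 (g23)) cannot supply ★ (E0)'s instance binder — the E ↦ E′ precedent of ROAD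
«UP-TR» (p852601).  The statements are byte-identical to ★ (E0)'s two heads up to that one binder; the proofs are ★ (E0)'s with `haveI := htHh T hT` at the per-member call
sites of ★ (E0a) and ★ (A1′)-D.  HONEST LABEL: count-neutral; `𝔇.Prop1252` stays a PRINTED consequent of `hBlock′` until the road's ★ rider; HC_CM is proved only modulo the 7
printed citations (2 remaining named inputs: hLiu418 = `stmt-HodgeConjecture-24832`, h413 = `stmt-HodgeConjecture-24833`) until rung 0 closes.

## References
* [Rogawski1990] J. D. Rogawski, *Automorphic Representations of Unitary Groups in Three Variables*, Ann. of Math. Stud. 123 (1990): §12.5 pp. 182–184; §3.6 L. 3.6.1 p. 28; §3.7 Prop. 3.7.1 p. 29.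
* [LanglandsShelstad1987] R. P. Langlands, D. Shelstad, *On the definition of transfer factors*, Math. Ann. 278 (1987), §1.3.
* [HarishChandra1970] Harish-Chandra (notes by G. van Dijk), *Harmonic analysis on reductive p-adic groups*, LNM 162 (1970), Part V §4 Lemma 42.
-/

set_option autoImplicit false
set_option linter.dupNamespace false

noncomputable section

open MeasureTheory Measure Set Function NumberField IsDedekindDomain Matrix
open Literature.NumberTheory.Automorphic Literature.NumberTheory.Automorphic.UnitaryGroup Literature.NumberTheory.Rogawski1990
open Literature.NumberTheory.GaloisRepresentations
open Summit.HodgeConjecture.HodgeConjecture.Cruxes.H413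
open Summit.HodgeConjecture.HodgeConjecture.Cruxes.H413.F0P3cStCharTSWeylCartanRadial
open Summit.HodgeConjecture.HodgeConjecture.Cruxes.H413.F0P3cStCharTSEllInnerTorusExchange
open Summit.HodgeConjecture.HodgeConjecture.Cruxes.H413.F0P3cStCharTSUpTrExchange
open Summit.HodgeConjecture.HodgeConjecture.Cruxes.H413.F0P3cStCharTSUpTrClaimP
open Summit.HodgeConjecture.HodgeConjecture.Cruxes.H413.F0P3cStCharTSUpEval
open scoped MatrixGroups Classical

namespace Summit.HodgeConjecture.HodgeConjecture.Cruxes.H413.F0P3cStCharTSEllInnerGRegroupPerT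

open Summit.HodgeConjecture.HodgeConjecture.Cruxes.H413.F0P3cStCharTSEllInnerGRegroup

variable (L : Type) [Field L] [NumberField L] [IsCMField L] (v : HeightOneSpectrum (𝓞 ↥(maximalRealSubfield L)))


/-! ## The two heads with a PER-MEMBER Haar letter `htHh : ∀ T ∈ SH, (tH T).IsHaarMeasure` instead of the total instance
(F0P3a-p06 (g23) 2026-09-02T20:26:36Z: the datum's `μTHf` is Haar only on the members — ★ R8 `hHaarHO`; the E ↦ E′ precedent p852601).  Everything else is ★ (E0)'s by name. -/

section RoadPerT

variable
    (hns : ∀ w : PlacesOver L v, IsCMField.complexConj L • w.1 = w.1)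
    [MeasurableSpace (Gqs L v)] [BorelSpace (Gqs L v)] [LocallyCompactSpace (Gqs L v)] [SecondCountableTopology (Gqs L v)] [T2Space (Gqs L v)]
    [IsTopologicalGroup (Gqs L v)]
    [MeasurableSpace ((UnitaryGroup.cmDatum L 2 (Matrix.of fun i j : Fin 2 => if i.val + j.val + 1 = 2 then (1 : L) else 0)).Local v × (UnitaryGroup.cmDatum L 1 (Matrix.of fun i j : Fin 1 => if i.val + j.val + 1 = 1 then (1 : L) else 0)).Local v)] [BorelSpace ((UnitaryGroup.cmDatum L 2 (Matrix.of fun i j : Fin 2 => if i.val + j.val + 1 = 2 then (1 : L) else 0)).Local v × (UnitaryGroup.cmDatum L 1 (Matrix.of fun i j : Fin 1 => if i.val + j.val + 1 = 1 then (1 : L) else 0)).Local v)]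
    -- the `H`-side compact Cartan system with embeddings and core-one Haar measures (★ (A1′)-E ∕ (P3) letters BY SHAPE; `hcomplete` for COMPACT centralisers = ★ R8 `hcovHO`'s scope)
    (SH : Finset (Subgroup ((UnitaryGroup.cmDatum L 2 (Matrix.of fun i j : Fin 2 => if i.val + j.val + 1 = 2 then (1 : L) else 0)).Local v × (UnitaryGroup.cmDatum L 1 (Matrix.of fun i j : Fin 1 => if i.val + j.val + 1 = 1 then (1 : L) else 0)).Local v))) (n : Subgroup ((UnitaryGroup.cmDatum L 2 (Matrix.of fun i j : Fin 2 => if i.val + j.val + 1 = 2 then (1 : L) else 0)).Local v × (UnitaryGroup.cmDatum L 1 (Matrix.of fun i j : Fin 1 => if i.val + j.val + 1 = 1 then (1 : L) else 0)).Local v) → ℕ)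
    (γc : (T : Subgroup ((UnitaryGroup.cmDatum L 2 (Matrix.of fun i j : Fin 2 => if i.val + j.val + 1 = 2 then (1 : L) else 0)).Local v × (UnitaryGroup.cmDatum L 1 (Matrix.of fun i j : Fin 1 => if i.val + j.val + 1 = 1 then (1 : L) else 0)).Local v)) → Fin (n T) → Gqs L v) (hγc : ∀ T ∈ SH, ∀ i : Fin (n T), IsRegularElt ((γc T i).val : GL (Fin 3) (UnitaryGroup.LocalRing L v)))
    (eT : (T : Subgroup ((UnitaryGroup.cmDatum L 2 (Matrix.of fun i j : Fin 2 => if i.val + j.val + 1 = 2 then (1 : L) else 0)).Local v × (UnitaryGroup.cmDatum L 1 (Matrix.of fun i j : Fin 1 => if i.val + j.val + 1 = 1 then (1 : L) else 0)).Local v)) → (i : Fin (n T)) → (↥T ≃ₜ* ↥(Subgroup.centralizer ({γc T i} : Set (Gqs L v)))))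
    (heT : ∀ T ∈ SH, ∀ (i : Fin (n T)) (s : ↥T), IsLocalNormPair L (qsForm L) v s.1 ((eT T i s : ↥(Subgroup.centralizer ({γc T i} : Set (Gqs L v)))) : Gqs L v))
    (ψ : (T : Subgroup ((UnitaryGroup.cmDatum L 2 (Matrix.of fun i j : Fin 2 => if i.val + j.val + 1 = 2 then (1 : L) else 0)).Local v × (UnitaryGroup.cmDatum L 1 (Matrix.of fun i j : Fin 1 => if i.val + j.val + 1 = 1 then (1 : L) else 0)).Local v)) → Fin (n T) → ((UnitaryGroup.cmDatum L 2 (Matrix.of fun i j : Fin 2 => if i.val + j.val + 1 = 2 then (1 : L) else 0)).Local v × (UnitaryGroup.cmDatum L 1 (Matrix.of fun i j : Fin 1 => if i.val + j.val + 1 = 1 then (1 : L) else 0)).Local v) → Gqs L v) (hψ : ∀ T ∈ SH, ∀ (i : Fin (n T)) (s : ↥T), ψ T i s.1 = ((eT T i s : ↥(Subgroup.centralizer ({γc T i} : Set (Gqs L v)))) : Gqs L v))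
    (fib : Gqs L v → (T : Subgroup ((UnitaryGroup.cmDatum L 2 (Matrix.of fun i j : Fin 2 => if i.val + j.val + 1 = 2 then (1 : L) else 0)).Local v × (UnitaryGroup.cmDatum L 1 (Matrix.of fun i j : Fin 1 => if i.val + j.val + 1 = 1 then (1 : L) else 0)).Local v)) → Fin (n T) → Finset ((UnitaryGroup.cmDatum L 2 (Matrix.of fun i j : Fin 2 => if i.val + j.val + 1 = 2 then (1 : L) else 0)).Local v × (UnitaryGroup.cmDatum L 1 (Matrix.of fun i j : Fin 1 => if i.val + j.val + 1 = 1 then (1 : L) else 0)).Local v))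
    (hfib : ∀ g : Gqs L v, ∀ T ∈ SH, ∀ (i : Fin (n T)) (x : ((UnitaryGroup.cmDatum L 2 (Matrix.of fun i j : Fin 2 => if i.val + j.val + 1 = 2 then (1 : L) else 0)).Local v × (UnitaryGroup.cmDatum L 1 (Matrix.of fun i j : Fin 1 => if i.val + j.val + 1 = 1 then (1 : L) else 0)).Local v)), x ∈ fib g T i ↔ x ∈ T ∧ IsLocalGRegular L v x ∧ IsConj (ψ T i x) g)
    (tH : (T : Subgroup ((UnitaryGroup.cmDatum L 2 (Matrix.of fun i j : Fin 2 => if i.val + j.val + 1 = 2 then (1 : L) else 0)).Local v × (UnitaryGroup.cmDatum L 1 (Matrix.of fun i j : Fin 1 => if i.val + j.val + 1 = 1 then (1 : L) else 0)).Local v)) → Measure ↥T)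
    (htHh : ∀ T ∈ SH, (tH T).IsHaarMeasure) (htHp : ∀ T ∈ SH, IsProbabilityMeasure (tH T))
    (hZ : ∀ T ∈ SH, ∃ γ₀ : ((UnitaryGroup.cmDatum L 2 (Matrix.of fun i j : Fin 2 => if i.val + j.val + 1 = 2 then (1 : L) else 0)).Local v × (UnitaryGroup.cmDatum L 1 (Matrix.of fun i j : Fin 1 => if i.val + j.val + 1 = 1 then (1 : L) else 0)).Local v), IsLocalGRegular L v γ₀ ∧ T = Subgroup.centralizer ({γ₀} : Set ((UnitaryGroup.cmDatum L 2 (Matrix.of fun i j : Fin 2 => if i.val + j.val + 1 = 2 then (1 : L) else 0)).Local v × (UnitaryGroup.cmDatum L 1 (Matrix.of fun i j : Fin 1 => if i.val + j.val + 1 = 1 then (1 : L) else 0)).Local v)))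
    (hKH : ∀ T ∈ SH, IsCompact (T : Set ((UnitaryGroup.cmDatum L 2 (Matrix.of fun i j : Fin 2 => if i.val + j.val + 1 = 2 then (1 : L) else 0)).Local v × (UnitaryGroup.cmDatum L 1 (Matrix.of fun i j : Fin 1 => if i.val + j.val + 1 = 1 then (1 : L) else 0)).Local v)))
    (hcomplete : ∀ h : ((UnitaryGroup.cmDatum L 2 (Matrix.of fun i j : Fin 2 => if i.val + j.val + 1 = 2 then (1 : L) else 0)).Local v × (UnitaryGroup.cmDatum L 1 (Matrix.of fun i j : Fin 1 => if i.val + j.val + 1 = 1 then (1 : L) else 0)).Local v), IsLocalGRegular L v h → IsCompact ((Subgroup.centralizer ({h} : Set ((UnitaryGroup.cmDatum L 2 (Matrix.of fun i j : Fin 2 => if i.val + j.val + 1 = 2 then (1 : L) else 0)).Local v × (UnitaryGroup.cmDatum L 1 (Matrix.of fun i j : Fin 1 => if i.val + j.val + 1 = 1 then (1 : L) else 0)).Local v)) : Subgroup ((UnitaryGroup.cmDatum L 2 (Matrix.of fun i j : Fin 2 => if i.val + j.val + 1 = 2 then (1 : L) else 0)).Local v × (UnitaryGroup.cmDatum L 1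 (Matrix.of fun i j : Fin 1 => if i.val + j.val + 1 = 1 then (1 : L) else 0)).Local v)) : Set ((UnitaryGroup.cmDatum L 2 (Matrix.of fun i j : Fin 2 => if i.val + j.val + 1 = 2 then (1 : L) else 0)).Local v × (UnitaryGroup.cmDatum L 1 (Matrix.of fun i j : Fin 1 => if i.val + j.val + 1 = 1 then (1 : L) else 0)).Local v)) → ∃ T ∈ SH, ∃ s ∈ T, IsConj h s)
    (hirred : ∀ T ∈ SH, ∀ T' ∈ SH, ∀ s ∈ T, ∀ s' ∈ T', IsLocalGRegular L v s → IsConj s s' → T = T')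
    (m : Subgroup ((UnitaryGroup.cmDatum L 2 (Matrix.of fun i j : Fin 2 => if i.val + j.val + 1 = 2 then (1 : L) else 0)).Local v × (UnitaryGroup.cmDatum L 1 (Matrix.of fun i j : Fin 1 => if i.val + j.val + 1 = 1 then (1 : L) else 0)).Local v) → ℕ)
    (hclasses : ∀ T ∈ SH, ∀ s ∈ T, IsLocalGRegular L v s →
      ∃ C : Finset ((UnitaryGroup.cmDatum L 2 (Matrix.of fun i j : Fin 2 => if i.val + j.val + 1 = 2 then (1 : L) else 0)).Local v × (UnitaryGroup.cmDatum L 1 (Matrix.of fun i j : Fin 1 => if i.val + j.val + 1 = 1 then (1 : L) else 0)).Local v), (∀ x ∈ C, IsLocalStablyConjH L v s x) ∧ (∀ x ∈ C, ∀ y ∈ C, IsConj x y → x = y) ∧ (∀ y, IsLocalStablyConjH L v s y → ∃ x ∈ C, IsConj y x) ∧ C.card = m T)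
    (hψR : ∀ T ∈ SH, ∀ (i : Fin (n T)), ∀ s ∈ T, IsLocalGRegular L v s → IsLocalNormPair L (qsForm L) v s (ψ T i s))
    (hψuniq : ∀ T ∈ SH, ∀ s ∈ T, IsLocalGRegular L v s → ∀ g : Gqs L v, IsLocalNormPair L (qsForm L) v s g → ∃! i : Fin (n T), IsConj (ψ T i s) g)
    -- the fibre count (T14-40 (α): theorem-level letter, discharged by (E2) FIBRE-ENUM — `3` on type (1), `1` on type (2))
    (cQ : Subgroup ((UnitaryGroup.cmDatum L 2 (Matrix.of fun i j : Fin 2 => if i.val + j.val + 1 = 2 then (1 : L) else 0)).Local v × (UnitaryGroup.cmDatum L 1 (Matrix.of fun i j : Fin 1 => if i.val + j.val + 1 = 1 then (1 : L) else 0)).Local v) → ℕ)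
    (hcQ : ∀ T ∈ SH, ∀ (i : Fin (n T)) (s : ↥T), IsLocalGRegular L v s.1 →
      ∃ Q : Finset ((UnitaryGroup.cmDatum L 2 (Matrix.of fun i j : Fin 2 => if i.val + j.val + 1 = 2 then (1 : L) else 0)).Local v × (UnitaryGroup.cmDatum L 1 (Matrix.of fun i j : Fin 1 => if i.val + j.val + 1 = 1 then (1 : L) else 0)).Local v), (∀ q ∈ Q, IsLocalGRegular L v q ∧ IsLocalNormPair L (qsForm L) v q ((eT T i s : ↥(Subgroup.centralizer ({γc T i} : Set (Gqs L v)))) : Gqs L v)) ∧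
        (∀ q ∈ Q, ∀ q' ∈ Q, IsLocalStablyConjH L v q q' → q = q') ∧
        (∀ a : ((UnitaryGroup.cmDatum L 2 (Matrix.of fun i j : Fin 2 => if i.val + j.val + 1 = 2 then (1 : L) else 0)).Local v × (UnitaryGroup.cmDatum L 1 (Matrix.of fun i j : Fin 1 => if i.val + j.val + 1 = 1 then (1 : L) else 0)).Local v), IsLocalGRegular L v a → IsLocalNormPair L (qsForm L) v a ((eT T i s : ↥(Subgroup.centralizer ({γc T i} : Set (Gqs L v)))) : Gqs L v) → ∃ q ∈ Q, IsLocalStablyConjH L v a q) ∧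
        Q.card = cQ T)
    -- the `G`-side elliptic Cartan system (★ RUNG0 v8 `hBlock′` letters `hcartO`, `hncGO` restricted to `Sell`, `hHaarGO`, `hcoreGO`) and where the embeddings land (`hcovE`)
    (Sell : Finset (Subgroup (Gqs L v))) (μTf : (T' : Subgroup (Gqs L v)) → Measure ↥T')
    (hcartO : ∀ T ∈ Sell, IsCompact (T : Set (Gqs L v)) ∧
      ∃ γ₀ : Gqs L v, IsRegularElt (γ₀.val : GL (Fin 3) (UnitaryGroup.LocalRing L v)) ∧ T = Subgroup.centralizer ({γ₀} : Set (Gqs L v)))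
    (hncG : ∀ T' ∈ Sell, ∀ T'' ∈ Sell, T' ≠ T'' → ∀ y : Gqs L v, ¬ ∀ h : Gqs L v, h ∈ T'' ↔ y⁻¹ * h * y ∈ T')
    (hHaarGO : ∀ T ∈ Sell, (μTf T).IsHaarMeasure) (hcoreGO : ∀ T' ∈ Sell, μTf T' (compactCore ↥T') = 1)
    (hcovE : ∀ T ∈ SH, ∀ i : Fin (n T), ∃ T₀ ∈ Sell, ∃ y : Gqs L v,
      ∀ g : Gqs L v, g ∈ Subgroup.centralizer ({γc T i} : Set (Gqs L v)) ↔ y⁻¹ * g * y ∈ T₀)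
    -- the integrand
    (Φ : Gqs L v → ℂ) (hΦc : ∀ x z : Gqs L v, IsConj x z → Φ x = Φ z)
    (hΦ0 : ∀ x : Gqs L v, (¬ ∃ q : ((UnitaryGroup.cmDatum L 2 (Matrix.of fun i j : Fin 2 => if i.val + j.val + 1 = 2 then (1 : L) else 0)).Local v × (UnitaryGroup.cmDatum L 1 (Matrix.of fun i j : Fin 1 => if i.val + j.val + 1 = 1 then (1 : L) else 0)).Local v), IsLocalGRegular L v q ∧ IsLocalNormPair L (qsForm L) v q x) → Φ x = 0)
    (hΦi : ∀ T' ∈ Sell, Integrable (fun t : ↥T' => Φ (t : Gqs L v)) (μTf T'))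

include hns hγc heT hψ hfib htHh htHp hZ hKH hcomplete hirred hclasses hψR hψuniq hcQ hcartO hncG hHaarGO hcoreGO hcovE hΦc hΦ0 hΦi in
/-- **(E0)′ «G-REGROUP, HAAR ON THE SYSTEM» — the transport companion AND the regrouping identity in ONE statement**, with the `H`-side torus measures asked to be Haar
PROBABILITY measures only on the members of `SH` (`htHh`, `htHp` = ★ R8's `hHaarHO`, `hprobHO` verbatim; no total instance, no `htH`): (1) each `Φ ∘ eT T i` is integrable on
the `G`-regular part of `T` (DERIVED by whole-measure transport — fence (γ)); (2) `Σ_{T′ ∈ Sell} ([N_G(T′):T′])⁻¹ ∫_{T′} Φ dμTf T′ = Σ_{T ∈ SH} ([N_H(T):T])⁻¹ (m T)⁻¹ (cQ T)⁻¹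
Σ_i ∫_{s ∈ T, G-regular} Φ(eT T i s) dtH T`.  Proofs = ★ (E0)'s with `haveI := htHh T hT` and `tH T (compactCore T) = 1` from compactness + probability at the per-member call
sites of ★ (E0a) and ★ (A1′)-D. [cite: Rogawski1990, §12.5 pp. 182–184; Prop. 12.5.2 p. 185] [cite: LanglandsShelstad1987, §1.3] [cite: HarishChandra1970, Part V §4 Lemma 42] -/
theorem integrableOn_and_ellipticTorusSum_eq_haarOn :
    (∀ T ∈ SH, ∀ i : Fin (n T),
      IntegrableOn (fun s : ↥T => Φ ((eT T i s : ↥(Subgroup.centralizer ({γc T i} : Set (Gqs L v)))) : Gqs L v)) {s : ↥T | IsLocalGRegular L v (s : ((UnitaryGroup.cmDatum L 2 (Matrix.of fun i j : Fin 2 => if i.val + j.val + 1 = 2 then (1 : L) else 0)).Local v × (UnitaryGroup.cmDatum L 1 (Matrix.of fun i j : Fin 1 => if i.val + j.val + 1 = 1 then (1 : L) else 0)).Local v))} (tH T)) ∧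
    ∑ T' ∈ Sell, (((T'.subgroupOf (Subgroup.normalizer (T' : Set (Gqs L v)))).index : ℂ))⁻¹ * ∫ x : ↥T', Φ (x : Gqs L v) ∂(μTf T') =
      ∑ T ∈ SH, ((((T.subgroupOf (Subgroup.normalizer (T : Set ((UnitaryGroup.cmDatum L 2 (Matrix.of fun i j : Fin 2 => if i.val + j.val + 1 = 2 then (1 : L) else 0)).Local v × (UnitaryGroup.cmDatum L 1 (Matrix.of fun i j : Fin 1 => if i.val + j.val + 1 = 1 then (1 : L) else 0)).Local v)))).index : ℂ))⁻¹ * ((m T : ℂ))⁻¹ * ((cQ T : ℂ))⁻¹) *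
        ∑ i : Fin (n T), ∫ s in {s : ↥T | IsLocalGRegular L v (s : ((UnitaryGroup.cmDatum L 2 (Matrix.of fun i j : Fin 2 => if i.val + j.val + 1 = 2 then (1 : L) else 0)).Local v × (UnitaryGroup.cmDatum L 1 (Matrix.of fun i j : Fin 1 => if i.val + j.val + 1 = 1 then (1 : L) else 0)).Local v))}, Φ ((eT T i s : ↥(Subgroup.centralizer ({γc T i} : Set (Gqs L v)))) : Gqs L v) ∂(tH T) := by
  refine ⟨fun T hT i => ?_, ?_⟩
  · -- (1) the transport companion
    obtain ⟨T₀, hT₀, y, hy⟩ := hcovE T hT i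
    obtain ⟨-, γ₀, hγ₀, hT₀eq⟩ := hcartO T₀ hT₀
    haveI : (μTf T₀).IsHaarMeasure := hHaarGO T₀ hT₀
    haveI : (tH T).IsHaarMeasure := htHh T hT
    obtain ⟨c, hc⟩ := exists_conj_continuousMulEquiv L v (Z := Subgroup.centralizer ({γc T i} : Set (Gqs L v))) y hy
    have hmap : Measure.map ((eT T i).trans c) (tH T) = μTf T₀ :=
      map_continuousMulEquiv_eq_of_apply_compactCore_eq_one L v T hT₀eq ((eT T i).trans c) (tH T) (by haveI : CompactSpace ↥T := isCompact_iff_compactSpace.1 (hKH T hT); haveI := htHp T hT; rw [compactCore_eq_univ]; exact measure_univ) (μTf T₀) (hcoreGO T₀ hT₀)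
    have hint : Integrable (fun x : ↥T₀ => Φ (x : Gqs L v)) (Measure.map ((eT T i).trans c) (tH T)) := by
      rw [hmap]; exact hΦi T₀ hT₀
    have hint' := (integrable_map_equiv ((eT T i).trans c).toHomeomorph.toMeasurableEquiv (fun x : ↥T₀ => Φ (x : Gqs L v))).1 hint
    have heq : (fun x : ↥T₀ => Φ (x : Gqs L v)) ∘ (((eT T i).trans c).toHomeomorph.toMeasurableEquiv) = fun s : ↥T => Φ ((eT T i s : ↥(Subgroup.centralizer ({γc T i} : Set (Gqs L v)))) : Gqs L v) := by
      funext s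
      show Φ ((((eT T i).trans c) s : ↥T₀) : Gqs L v) = Φ ((eT T i s : ↥(Subgroup.centralizer ({γc T i} : Set (Gqs L v)))) : Gqs L v)
      rw [ContinuousMulEquiv.trans_apply, hc]
      exact hΦc _ _ (isConj_iff.2 ⟨y, by group⟩)
    rw [heq] at hint'
    exact hint'.integrableOn
  · -- (2) the regrouping identity
    have hΦ0' := apply_eq_zero_of_not_isRegularElt L v Φ hΦ0
    -- Step 1: inside each `∫_{T′}`, the pointwise density and the exchange of the finite sums with the integral
    have hstep : ∀ T' ∈ Sell, ∫ x : ↥T', Φ (x : Gqs L v) ∂(μTf T') =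
        ∑ T ∈ SH, ((((T.subgroupOf (Subgroup.normalizer (T : Set ((UnitaryGroup.cmDatum L 2 (Matrix.of fun i j : Fin 2 => if i.val + j.val + 1 = 2 then (1 : L) else 0)).Local v × (UnitaryGroup.cmDatum L 1 (Matrix.of fun i j : Fin 1 => if i.val + j.val + 1 = 1 then (1 : L) else 0)).Local v)))).index : ℂ))⁻¹ * ((m T : ℂ))⁻¹ * ((cQ T : ℂ))⁻¹) * ∑ i : Fin (n T), ∫ x : ↥T', (({s : ↥T | IsConj ((eT T i s : ↥(Subgroup.centralizer ({γc T i} : Set (Gqs L v)))) : Gqs L v) ((x : ↥T') : Gqs L v)}.ncard : ℂ)) * Φ ((x : ↥T') : Gqs L v) ∂(μTf T') := by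
      intro T' hT'
      obtain ⟨hT'c, γ₀', hγ₀', hT'eq⟩ := hcartO T' hT'
      have hpt : ∀ x : ↥T', Φ (x : Gqs L v) = ∑ T ∈ SH, ((((T.subgroupOf (Subgroup.normalizer (T : Set ((UnitaryGroup.cmDatum L 2 (Matrix.of fun i j : Fin 2 => if i.val + j.val + 1 = 2 then (1 : L) else 0)).Local v × (UnitaryGroup.cmDatum L 1 (Matrix.of fun i j : Fin 1 => if i.val + j.val + 1 = 1 then (1 : L) else 0)).Local v)))).index : ℂ))⁻¹ * ((m T : ℂ))⁻¹ * ((cQ T : ℂ))⁻¹) * ∑ i : Fin (n T), ((({s : ↥T | IsConj ((eT T i s : ↥(Subgroup.centralizer ({γc T i} : Set (Gqs L v)))) : Gqs L v) ((x : ↥T') : Gqs L v)}.ncard : ℂ)) * Φ ((x : ↥T') : Gqs L v)) :=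
        fun x => apply_eq_sum_weight_mul_sum_ncard_mul L v hns SH n γc eT heT ψ hψ fib hfib hZ hKH hcomplete hirred m hclasses hψR hψuniq cQ hcQ Φ hΦ0
          (x : Gqs L v) (fun hx => by rw [centralizer_eq_cartan_of_isRegularElt hγ₀' hT'eq x hx]; exact hT'c)
      have hI : ∀ T ∈ SH, ∀ i : Fin (n T), Integrable (fun x : ↥T' => (({s : ↥T | IsConj ((eT T i s : ↥(Subgroup.centralizer ({γc T i} : Set (Gqs L v)))) : Gqs L v) ((x : ↥T') : Gqs L v)}.ncard : ℂ)) * Φ ((x : ↥T') : Gqs L v)) (μTf T') :=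
        fun T hT i => integrable_ncard_mul L v SH n γc hγc eT Sell μTf hcartO hncG hcovE Φ hΦ0 hΦi hT' hT i
      rw [integral_congr_ae (ae_of_all _ hpt),
        integral_finsetSum _ (fun T hT => (integrable_finsetSum _ fun i _ => hI T hT i).const_mul _)]
      refine Finset.sum_congr rfl fun T hT => ?_
      rw [integral_const_mul, integral_finsetSum _ (fun i _ => hI T hT i)]
    -- Step 2: the algebra of the finite sums and ★ (E0a) per `(T, i)`
    calc ∑ T' ∈ Sell, (((T'.subgroupOf (Subgroup.normalizer (T' : Set (Gqs L v)))).index : ℂ))⁻¹ * ∫ x : ↥T', Φ (x : Gqs L v) ∂(μTf T')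
        = ∑ T' ∈ Sell, ∑ T ∈ SH, ∑ i : Fin (n T), ((((T.subgroupOf (Subgroup.normalizer (T : Set ((UnitaryGroup.cmDatum L 2 (Matrix.of fun i j : Fin 2 => if i.val + j.val + 1 = 2 then (1 : L) else 0)).Local v × (UnitaryGroup.cmDatum L 1 (Matrix.of fun i j : Fin 1 => if i.val + j.val + 1 = 1 then (1 : L) else 0)).Local v)))).index : ℂ))⁻¹ * ((m T : ℂ))⁻¹ * ((cQ T : ℂ))⁻¹) * ((((T'.subgroupOf (Subgroup.normalizer (T' : Set (Gqs L v)))).index : ℂ))⁻¹ * ∫ x : ↥T', (({s : ↥T | IsConj ((eT T i s : ↥(Subgroup.centralizer ({γc T i} : Set (Gqs L v)))) : Gqs L v) ((x : ↥T') : Gqs L v)}.ncard : ℂ)) * Φ ((x : ↥T') : Gqs L v) ∂(μTf T')) := by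
          refine Finset.sum_congr rfl fun T' hT' => ?_
          rw [hstep T' hT', Finset.mul_sum]
          refine Finset.sum_congr rfl fun T _ => ?_
          rw [Finset.mul_sum, Finset.mul_sum]
          refine Finset.sum_congr rfl fun i _ => ?_
          ring
      _ = ∑ T ∈ SH, ∑ T' ∈ Sell, ∑ i : Fin (n T), ((((T.subgroupOf (Subgroup.normalizer (T : Set ((UnitaryGroup.cmDatum L 2 (Matrix.of fun i j : Fin 2 => if i.val + j.val + 1 = 2 then (1 : L) else 0)).Local v × (UnitaryGroup.cmDatum L 1 (Matrix.of fun i j : Fin 1 => if i.val + j.val + 1 = 1 then (1 : L) else 0)).Local v)))).index : ℂ))⁻¹ * ((m T : ℂ))⁻¹ * ((cQ T : ℂ))⁻¹) * ((((T'.subgroupOf (Subgroup.normalizer (T' : Set (Gqs L v)))).index : ℂ))⁻¹ * ∫ x : ↥T', (({s : ↥T | IsConj ((eT T i s : ↥(Subgroup.centralizer ({γc T i} : Set (Gqs L v)))) : Gqs L v) ((x : ↥T') : Gqs L v)}.ncard : ℂ)) * Φ ((x : ↥T') : Gqs L v) ∂(μTf T')) := Finset.sum_comm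
      _ = ∑ T ∈ SH, ((((T.subgroupOf (Subgroup.normalizer (T : Set ((UnitaryGroup.cmDatum L 2 (Matrix.of fun i j : Fin 2 => if i.val + j.val + 1 = 2 then (1 : L) else 0)).Local v × (UnitaryGroup.cmDatum L 1 (Matrix.of fun i j : Fin 1 => if i.val + j.val + 1 = 1 then (1 : L) else 0)).Local v)))).index : ℂ))⁻¹ * ((m T : ℂ))⁻¹ * ((cQ T : ℂ))⁻¹) * ∑ i : Fin (n T), ∑ T' ∈ Sell, (((T'.subgroupOf (Subgroup.normalizer (T' : Set (Gqs L v)))).index : ℂ))⁻¹ * ∫ x : ↥T', (({s : ↥T | IsConj ((eT T i s : ↥(Subgroup.centralizer ({γc T i} : Set (Gqs L v)))) : Gqs L v) ((x : ↥T') : Gqs L v)}.ncard : ℂ)) * Φ ((x : ↥T') : Gqs L v) ∂(μTf T') := by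
          refine Finset.sum_congr rfl fun T _ => ?_
          rw [Finset.sum_comm, Finset.mul_sum]
          refine Finset.sum_congr rfl fun i _ => ?_
          rw [Finset.mul_sum]
      _ = ∑ T ∈ SH, ((((T.subgroupOf (Subgroup.normalizer (T : Set ((UnitaryGroup.cmDatum L 2 (Matrix.of fun i j : Fin 2 => if i.val + j.val + 1 = 2 then (1 : L) else 0)).Local v × (UnitaryGroup.cmDatum L 1 (Matrix.of fun i j : Fin 1 => if i.val + j.val + 1 = 1 then (1 : L) else 0)).Local v)))).index : ℂ))⁻¹ * ((m T : ℂ))⁻¹ * ((cQ T : ℂ))⁻¹) * ∑ i : Fin (n T), ∫ s : ↥T, Φ ((eT T i s : ↥(Subgroup.centralizer ({γc T i} : Set (Gqs L v)))) : Gqs L v) ∂(tH T) := by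
          refine Finset.sum_congr rfl fun T hT => ?_
          congr 1
          refine Finset.sum_congr rfl fun i _ => ?_
          obtain ⟨T₀, hT₀, y, hy⟩ := hcovE T hT i
          haveI : (tH T).IsHaarMeasure := htHh T hT
          exact sum_invIndex_mul_integral_ncard_mul_eq_integral_comp L v hns T (tH T) (by haveI : CompactSpace ↥T := isCompact_iff_compactSpace.1 (hKH T hT); haveI := htHp T hT; rw [compactCore_eq_univ]; exact measure_univ) Sell μTf hcartO hncG hHaarGO hcoreGO (hγc T hT i) (eT T i) hT₀ y hy Φ hΦc hΦ0'
      _ = _ := by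
          refine Finset.sum_congr rfl fun T hT => ?_
          congr 1
          refine Finset.sum_congr rfl fun i _ => ?_
          refine (setIntegral_eq_integral_of_forall_compl_eq_zero fun s hs => hΦ0' _ fun hreg => hs ?_).symm
          exact (isLocalGRegular_iff_isRegularElt_of_isLocalNormPair L v (heT T hT i s)).2 hreg

end RoadPerT

end Summit.HodgeConjecture.HodgeConjecture.Cruxes.H413.F0P3cStCharTSEllInnerGRegroupPerT
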